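import Summits.RiemannHypothesis.RiemannHypothesis.Theorems.SignConeSignConeOscillatoryOfFakeZeroMeasure
import Summits.RiemannHypothesis.RiemannHypothesis.Theorems.SignConeSignConeOscillatoryEnvelope
import Literature.NumberTheory.LFunctions.WeilExplicitFormulaProofs
import Literature.NumberTheory.LFunctions.WeilZeroSum
import Literature.NumberTheory.LFunctions.WeilExplicitContinuous
import Mathlib.MeasureTheory.Integral.Bochner.SumMeasure

/-!
# Stub `stub_fakeZeroMeasure_of_riemannHypothesis` for crux `SignCone.SignConeOscillatory`
(stmt-RiemannHypothesis-16302), line Sketch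

The RH-ENVELOPE of the line's terminal stub (the spectral fake-zero certificate): under Mathlib's
`RiemannHypothesis`, for every cutoff `a > 0` the certificate exists with
`N := ⌈e^{2a}⌉₊`, the von Mangoldt weights `c := Λ`, and the positive measure on the critical line
`σ := dy/2π + Σ_ρ m(ρ) δ_{Im ρ}` (the non-trivial zeros of `ζ`, with multiplicity, projected to their
ordinates).

Write `k := g ⋆ g̃ = weilConv g (weilReflect g)` and `ĝ(y) := weilMellin g (1/2 + iy)`, so that
`k̂(1/2 + iy) = |ĝ(y)|²` (`weilMellin_weilConv_weilReflect_half`).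

* LEFT side. `spectralArchPolar`: `-(1/2π) ∫ |ĝ|² J_N = Re W_ar(k) + ‖g‖₂²`; `stub_combPairing`:
  `(1/2π) ∫ |ĝ|² comb_Λ = Σ_{2 ≤ n ≤ N} Λ(n) · 2 Re k(log n)/√n`, and this finite node sum is the prime
  term `weilPrimeTerm k` (`tsupport k ⊆ [-2a, 2a]`, `e^{2a} ≤ N`, hermitian symmetry
  `k(L) + k(-L) = 2 Re k(L)`). Hence LEFT `= Re W(k) + ‖g‖₂²` (`weilFunctional = polar - prime + arch`).
* RIGHT side. `∫ |ĝ|² dσ = (1/2π) ∫ |ĝ|² dy + Σ_ρ m(ρ) |ĝ(Im ρ)|²`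
  (`integral_add_measure`, `integral_smul_measure`, `integral_sum_dirac`; the zero sum converges by
  `|ĝ(1/2+iy)|² ≪ (1+y²)⁻²` against `weilZeroSummable`), and `(1/2π) ∫ |ĝ|² = ‖g‖₂²` (Plancherel,
  `integral_norm_sq_weilMellin_half_line`). Under RH every non-trivial zero is `ρ = 1/2 + i Im ρ`, so
  `m(ρ) |ĝ(Im ρ)|² = m(ρ) k̂(ρ)` and `Σ_ρ m(ρ) k̂(ρ) = W(k)` by the explicit formula
  (`hasWeilZeroSide_tsum`, `summable_norm_zeroSide`, `eq_weilFunctional_of_hasWeilZeroSide`).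

Both sides equal `Re W(k) + ‖g‖₂²`.
-/

noncomputable section
set_option linter.dupNamespace false
open scoped BigOperators ComplexConjugate Real ENNReal
open Complex MeasureTheory Set Filter

namespace Summit.RiemannHypothesis.RiemannHypothesis.Theorems.SignConeOscillatory

open Literature.NumberTheory.LFunctions
open Summit.RiemannHypothesis.RiemannHypothesis.Theorems.SignCone
open scoped ArithmeticFunction.vonMangoldt

/-! ## The prime term of `k = g ⋆ g̃` as the `Λ`-comb node sum -/

/-- For `tsupport g ⊆ [-a, a]` and `e^{2a} ≤ N`, the prime term of `k = g ⋆ g̃` is the finite node sum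
`Σ_{2 ≤ n ≤ N} Λ(n) · 2 Re k(log n)/√n` (as a real number cast to `ℂ`): `Λ(0) = Λ(1) = 0`, the nodes
`log n > 2a` (`n > N`) lie outside `tsupport k ⊆ [-2a, 2a]`, and `k(log n) + k(-log n) = 2 Re k(log n)`. -/
theorem weilPrimeTerm_weilConv_weilReflect_eq_sum {g : ℝ → ℂ} (hg : IsWeilTest g) {a : ℝ}
    (hsupp : tsupport g ⊆ Set.Icc (-a) a) {N : ℕ} (hNa : Real.exp (2 * a) ≤ N) :
    weilPrimeTerm (weilConv g (weilReflect g)) =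
      ((∑ n ∈ Finset.Icc 2 N,
          Λ n * (2 * (weilConv g (weilReflect g) (Real.log n)).re) / Real.sqrt n : ℝ) : ℂ) := by
  have hk2a : tsupport (weilConv g (weilReflect g)) ⊆ Set.Icc (-(2 * a)) (2 * a) :=
    tsupport_weilConv_weilReflect_subset (a := a) hg.2 hsupp
  have hzero : ∀ u : ℝ, 2 * a < |u| → weilConv g (weilReflect g) u = 0 := fun u hu =>
    image_eq_zero_of_notMem_tsupport fun h => by
      have h' : |u| ≤ 2 * a := abs_le.2 (Set.mem_Icc.1 (hk2a h))
      linarith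
  unfold weilPrimeTerm
  rw [tsum_eq_sum (s := Finset.Icc 2 N) ?_]
  · push_cast
    refine Finset.sum_congr rfl fun n _ => ?_
    rw [weilConv_weilReflect_add_neg_eq_two_re g (Real.log n)]
    push_cast
    ring
  · intro n hn
    rw [Finset.mem_Icc, not_and_or, not_le, not_le] at hn
    rcases hn with hn | hn
    · interval_cases n <;> simp
    · have hn' : Real.exp (2 * a) < n := hNa.trans_lt (by exact_mod_cast hn)
      have hpos : (0 : ℝ) < n := (Real.exp_pos _).trans hn'
      have hlog : 2 * a < Real.log n := by rwa [Real.lt_log_iff_exp_lt hpos]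
      have h1 : 2 * a < |Real.log n| := hlog.trans_le (le_abs_self _)
      rw [hzero _ h1, hzero _ (by rwa [abs_neg]), add_zero, mul_zero]

/-- **LEFT side of the certificate identity.** For `tsupport g ⊆ [-a, a]`, `e^{2a} ≤ N` and the von
Mangoldt comb `c = Λ`:
`-(1/2π) ∫ |ĝ|² J_N − (1/2π) ∫ |ĝ|² comb_Λ = Re W(g ⋆ g̃) + ‖g‖₂²`
(`spectralArchPolar`, `stub_combPairing`, `weilPrimeTerm_weilConv_weilReflect_eq_sum`). -/
theorem spectralCertificate_lhs_eq_weilFunctional_re {g : ℝ → ℂ} (hg : IsWeilTest g) {a : ℝ}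
    (hsupp : tsupport g ⊆ Set.Icc (-a) a) {N : ℕ} (hNa : Real.exp (2 * a) ≤ N) :
    -(1 / (2 * π)) * (∫ y : ℝ, ‖weilMellin g (1 / 2 + y * I)‖ ^ 2 *
        (2 * (riemannZeta (1 / 2 + y * I)
                - ∑ n ∈ Finset.Icc 1 N, (n : ℂ) ^ (-(1 / 2 + y * I))).re
          - (Complex.digamma (1 / 4 + y / 2 * I)).re + Real.log π - 1))
      - 1 / (2 * π) * (∫ y : ℝ, ‖weilMellin g (1 / 2 + y * I)‖ ^ 2 *
          ∑ n ∈ Finset.Icc 2 N, Λ n * (2 * Real.cos (y * Real.log n)) / Real.sqrt n)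
      = (weilFunctional (weilConv g (weilReflect g))).re + ∫ t : ℝ, ‖g t‖ ^ 2 := by
  rw [← spectralArchPolar g hg hsupp hNa, (stub_combPairing g N (fun n => Λ n) hg).2]
  have hP : (weilPrimeTerm (weilConv g (weilReflect g))).re =
      ∑ n ∈ Finset.Icc 2 N,
        Λ n * (2 * (weilConv g (weilReflect g) (Real.log n)).re) / Real.sqrt n := by
    rw [weilPrimeTerm_weilConv_weilReflect_eq_sum hg hsupp hNa, Complex.ofReal_re]
  simp only [weilFunctional, Complex.add_re, Complex.sub_re, hP]
  ring

/-! ## The zeros under RH -/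

/-- Multiplicities of non-trivial zeros are non-negative (as real numbers). -/
theorem riemannZetaZeroOrder_coe_nonneg (ρ : ZetaZeros.riemannZetaNontrivialZeros) :
    (0 : ℝ) ≤ riemannZetaZeroOrder (ρ : ℂ) := by
  exact_mod_cast riemannZetaZeroOrder_nonneg (ZetaZeros.riemannZetaNontrivialZeros.ne_one ρ.2)

/-- Under `RiemannHypothesis` every non-trivial zero has real part `1/2` (it is a zero, it is not a
trivial zero since `Im ρ ≠ 0`, and it is `≠ 1`). -/
theorem re_eq_half_of_riemannHypothesis (hRH : RiemannHypothesis)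
    (ρ : ZetaZeros.riemannZetaNontrivialZeros) : (ρ : ℂ).re = 1 / 2 := by
  refine hRH ρ (ZetaZeros.riemannZetaNontrivialZeros.zeta_eq_zero ρ.2) ?_
    (ZetaZeros.riemannZetaNontrivialZeros.ne_one ρ.2)
  rintro ⟨n, hn⟩
  have him := ZetaZeros.riemannZetaNontrivialZeros.im_ne_zero ρ.2
  rw [hn] at him
  simp at him

/-- Under `RiemannHypothesis`, a non-trivial zero is `ρ = 1/2 + i Im ρ`. -/
theorem eq_half_add_im_mul_I_of_riemannHypothesis (hRH : RiemannHypothesis)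
    (ρ : ZetaZeros.riemannZetaNontrivialZeros) :
    (ρ : ℂ) = 1 / 2 + (((ρ : ℂ).im : ℝ) : ℂ) * I := by
  apply Complex.ext
  · rw [re_eq_half_of_riemannHypothesis hRH ρ]
    simp
  · simp

/-- Under `RiemannHypothesis`, the transform of `k = g ⋆ g̃` at a non-trivial zero `ρ` is the squared
modulus `|ĝ(1/2 + i Im ρ)|²` (`weilMellin_weilConv_weilReflect_half` at `ρ = 1/2 + i Im ρ`). -/
theorem weilMellin_weilConv_weilReflect_zero_of_riemannHypothesis (hRH : RiemannHypothesis)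
    {g : ℝ → ℂ} (hg : IsWeilTest g) (ρ : ZetaZeros.riemannZetaNontrivialZeros) :
    weilMellin (weilConv g (weilReflect g)) ρ =
      ((‖weilMellin g (1 / 2 + (((ρ : ℂ).im : ℝ) : ℂ) * I)‖ ^ 2 : ℝ) : ℂ) := by
  rw [← weilMellin_weilConv_weilReflect_half hg]
  exact congrArg _ (eq_half_add_im_mul_I_of_riemannHypothesis hRH ρ)

/-- The zero sum `Σ_ρ m(ρ) |ĝ(1/2 + i Im ρ)|²` converges absolutely (unconditionally):
`|ĝ(1/2 + iy)|² ≤ D² (1 + y²)⁻²` (`norm_sq_weilMellin_half_line_le`) against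
`Σ_ρ m(ρ)/(1 + (Im ρ)²)² < ∞` (`weilZeroSummable`). -/
theorem summable_order_mul_norm_sq_weilMellin {g : ℝ → ℂ} (hg : IsWeilTest g) :
    Summable fun ρ : ZetaZeros.riemannZetaNontrivialZeros =>
      (riemannZetaZeroOrder (ρ : ℂ) : ℝ) * ‖weilMellin g (1 / 2 + (((ρ : ℂ).im : ℝ) : ℂ) * I)‖ ^ 2 := by
  refine Summable.of_nonneg_of_le
    (fun ρ => mul_nonneg (riemannZetaZeroOrder_coe_nonneg ρ) (by positivity)) (fun ρ => ?_)
    (weilZeroSummable.mul_left (weilDecayW 0 g ^ 2))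
  have hm := riemannZetaZeroOrder_coe_nonneg ρ
  calc (riemannZetaZeroOrder (ρ : ℂ) : ℝ) * ‖weilMellin g (1 / 2 + (((ρ : ℂ).im : ℝ) : ℂ) * I)‖ ^ 2
      ≤ (riemannZetaZeroOrder (ρ : ℂ) : ℝ) *
          (weilDecayW 0 g ^ 2 * ((1 + ((ρ : ℂ).im) ^ 2)⁻¹) ^ 2) :=
        mul_le_mul_of_nonneg_left (norm_sq_weilMellin_half_line_le hg _) hm
    _ = weilDecayW 0 g ^ 2 * weilZeroWeight (ρ : ℂ) := by
        rw [weilZeroWeight, div_eq_mul_inv, ← inv_pow]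
        ring

/-- **The zero sum under RH.** `Σ_ρ m(ρ) |ĝ(1/2 + i Im ρ)|² = Re W(g ⋆ g̃)`: each term is
`m(ρ) k̂(ρ)` (`weilMellin_weilConv_weilReflect_zero_of_riemannHypothesis`), and
`Σ_ρ m(ρ) k̂(ρ) = W(k)` by the explicit formula (`hasWeilZeroSide_tsum`, `summable_norm_zeroSide`,
`eq_weilFunctional_of_hasWeilZeroSide`). -/
theorem tsum_order_mul_norm_sq_weilMellin_of_riemannHypothesis (hRH : RiemannHypothesis)
    {g : ℝ → ℂ} (hg : IsWeilTest g) :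
    ∑' ρ : ZetaZeros.riemannZetaNontrivialZeros,
        (riemannZetaZeroOrder (ρ : ℂ) : ℝ) * ‖weilMellin g (1 / 2 + (((ρ : ℂ).im : ℝ) : ℂ) * I)‖ ^ 2
      = (weilFunctional (weilConv g (weilReflect g))).re := by
  have hk : IsWeilTest (weilConv g (weilReflect g)) := hg.weilConv hg.weilReflect
  have hW : ∑' ρ : ZetaZeros.riemannZetaNontrivialZeros,
      (riemannZetaZeroOrder (ρ : ℂ) : ℂ) * weilMellin (weilConv g (weilReflect g)) ρ
        = weilFunctional (weilConv g (weilReflect g)) :=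
    eq_weilFunctional_of_hasWeilZeroSide hk (hasWeilZeroSide_tsum (summable_norm_zeroSide hk))
  have hsum : ∑' ρ : ZetaZeros.riemannZetaNontrivialZeros,
      (riemannZetaZeroOrder (ρ : ℂ) : ℂ) * weilMellin (weilConv g (weilReflect g)) ρ
        = ((∑' ρ : ZetaZeros.riemannZetaNontrivialZeros, (riemannZetaZeroOrder (ρ : ℂ) : ℝ) *
            ‖weilMellin g (1 / 2 + (((ρ : ℂ).im : ℝ) : ℂ) * I)‖ ^ 2 : ℝ) : ℂ) := by
    rw [Complex.ofReal_tsum]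
    refine tsum_congr fun ρ => ?_
    rw [weilMellin_weilConv_weilReflect_zero_of_riemannHypothesis hRH hg ρ]
    push_cast
    ring
  rw [← hW, hsum, Complex.ofReal_re]

/-! ## The measure `dy/2π + Σ_ρ m(ρ) δ_{Im ρ}` -/

/-- **RIGHT side of the certificate identity.** Against `σ = dy/2π + Σ_ρ m(ρ) δ_{Im ρ}` the spectral
density `|ĝ(1/2 + iy)|²` of a Weil test `g` is integrable, and
`∫ |ĝ|² dσ = ‖g‖₂² + Σ_ρ m(ρ) |ĝ(1/2 + i Im ρ)|²` (Plancherel `(1/2π) ∫ |ĝ|² = ‖g‖₂²`,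
`integral_sum_dirac`, `summable_order_mul_norm_sq_weilMellin`). -/
theorem integral_norm_sq_weilMellin_fakeZeroMeasure {g : ℝ → ℂ} (hg : IsWeilTest g) :
    Integrable (fun y : ℝ => ‖weilMellin g (1 / 2 + y * I)‖ ^ 2)
        ((ENNReal.ofReal (1 / (2 * π))) • (volume : Measure ℝ) +
          Measure.sum (fun ρ : ZetaZeros.riemannZetaNontrivialZeros =>
            (ENNReal.ofReal (riemannZetaZeroOrder (ρ : ℂ) : ℝ)) • Measure.dirac ((ρ : ℂ).im))) ∧
      ∫ y : ℝ, ‖weilMellin g (1 / 2 + y * I)‖ ^ 2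
          ∂((ENNReal.ofReal (1 / (2 * π))) • (volume : Measure ℝ) +
            Measure.sum (fun ρ : ZetaZeros.riemannZetaNontrivialZeros =>
              (ENNReal.ofReal (riemannZetaZeroOrder (ρ : ℂ) : ℝ)) • Measure.dirac ((ρ : ℂ).im)))
        = (∫ t : ℝ, ‖g t‖ ^ 2) +
            ∑' ρ : ZetaZeros.riemannZetaNontrivialZeros, (riemannZetaZeroOrder (ρ : ℂ) : ℝ) *
              ‖weilMellin g (1 / 2 + (((ρ : ℂ).im : ℝ) : ℂ) * I)‖ ^ 2 := by
  have hc0 : (0 : ℝ) ≤ 1 / (2 * π) := by positivity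
  have hm0 := riemannZetaZeroOrder_coe_nonneg
  have hΦ0 : ∀ y : ℝ, 0 ≤ ‖weilMellin g (1 / 2 + y * I)‖ ^ 2 := fun y => by positivity
  have hI1 : Integrable (fun y : ℝ => ‖weilMellin g (1 / 2 + y * I)‖ ^ 2)
      ((ENNReal.ofReal (1 / (2 * π))) • (volume : Measure ℝ)) :=
    (integrable_norm_sq_weilMellin_half_line hg).smul_measure ENNReal.ofReal_ne_top
  have hS : Summable fun ρ : ZetaZeros.riemannZetaNontrivialZeros =>
      (ENNReal.ofReal (riemannZetaZeroOrder (ρ : ℂ) : ℝ)).toReal *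
        ‖(‖weilMellin g (1 / 2 + (((ρ : ℂ).im : ℝ) : ℂ) * I)‖ ^ 2)‖ := by
    refine (summable_order_mul_norm_sq_weilMellin hg).congr fun ρ => ?_
    rw [ENNReal.toReal_ofReal (hm0 ρ), Real.norm_of_nonneg (hΦ0 _)]
  have hI2 : Integrable (fun y : ℝ => ‖weilMellin g (1 / 2 + y * I)‖ ^ 2)
      (Measure.sum (fun ρ : ZetaZeros.riemannZetaNontrivialZeros =>
        (ENNReal.ofReal (riemannZetaZeroOrder (ρ : ℂ) : ℝ)) • Measure.dirac ((ρ : ℂ).im))) :=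
    integrable_sum_dirac (fun _ => ENNReal.ofReal_ne_top) hS
  refine ⟨hI1.add_measure hI2, ?_⟩
  rw [integral_add_measure hI1 hI2, integral_smul_measure,
    integral_sum_dirac (fun _ => ENNReal.ofReal_ne_top), ENNReal.toReal_ofReal hc0,
    integral_norm_sq_weilMellin_half_line hg, smul_eq_mul]
  congr 1
  · have h2π : (2 * π : ℝ) ≠ 0 := by positivity
    rw [one_div, inv_mul_cancel_left₀ h2π]
    rfl
  · exact tsum_congr fun ρ => by rw [ENNReal.toReal_ofReal (hm0 ρ), smul_eq_mul]

/-- **The certificate identity under RH, at a given cutoff.** For `tsupport g ⊆ [-a, a]` and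
`e^{2a} ≤ N`, with `c = Λ` and `σ = dy/2π + Σ_ρ m(ρ) δ_{Im ρ}`:
`|ĝ|²` is `σ`-integrable and `-(1/2π) ∫ |ĝ|² J_N − (1/2π) ∫ |ĝ|² comb_Λ = ∫ |ĝ|² dσ`
(both sides equal `Re W(g ⋆ g̃) + ‖g‖₂²`). -/
theorem fakeZeroMeasure_certificate_of_riemannHypothesis (hRH : RiemannHypothesis) {g : ℝ → ℂ}
    (hg : IsWeilTest g) {a : ℝ} (hsupp : tsupport g ⊆ Set.Icc (-a) a) {N : ℕ}
    (hNa : Real.exp (2 * a) ≤ N) :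
    Integrable (fun y : ℝ => ‖weilMellin g (1 / 2 + y * I)‖ ^ 2)
        ((ENNReal.ofReal (1 / (2 * π))) • (volume : Measure ℝ) +
          Measure.sum (fun ρ : ZetaZeros.riemannZetaNontrivialZeros =>
            (ENNReal.ofReal (riemannZetaZeroOrder (ρ : ℂ) : ℝ)) • Measure.dirac ((ρ : ℂ).im))) ∧
      -(1 / (2 * π)) * (∫ y : ℝ, ‖weilMellin g (1 / 2 + y * I)‖ ^ 2 *
          (2 * (riemannZeta (1 / 2 + y * I)
                  - ∑ n ∈ Finset.Icc 1 N, (n : ℂ) ^ (-(1 / 2 + y * I))).re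
            - (Complex.digamma (1 / 4 + y / 2 * I)).re + Real.log π - 1))
        - 1 / (2 * π) * (∫ y : ℝ, ‖weilMellin g (1 / 2 + y * I)‖ ^ 2 *
            ∑ n ∈ Finset.Icc 2 N, Λ n * (2 * Real.cos (y * Real.log n)) / Real.sqrt n)
        = ∫ y : ℝ, ‖weilMellin g (1 / 2 + y * I)‖ ^ 2
            ∂((ENNReal.ofReal (1 / (2 * π))) • (volume : Measure ℝ) +
              Measure.sum (fun ρ : ZetaZeros.riemannZetaNontrivialZeros =>
                (ENNReal.ofReal (riemannZetaZeroOrder (ρ : ℂ) : ℝ)) • Measure.dirac ((ρ : ℂ).im))) := by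
  obtain ⟨hI, hσ⟩ := integral_norm_sq_weilMellin_fakeZeroMeasure hg
  refine ⟨hI, ?_⟩
  rw [hσ, spectralCertificate_lhs_eq_weilFunctional_re hg hsupp hNa,
    tsum_order_mul_norm_sq_weilMellin_of_riemannHypothesis hRH hg, add_comm]

/-! ## The registered stub -/

/-- STUB `stub_fakeZeroMeasure_of_riemannHypothesis` (the RH-envelope of the line's terminal stub
`stub_fakeZeroMeasure`): under `RiemannHypothesis`, for every `a > 0` the spectral fake-zero certificate
exists, with `N = ⌈e^{2a}⌉₊`, `c = Λ ≥ 0` and `σ = dy/2π + Σ_ρ m(ρ) δ_{Im ρ}`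
(`fakeZeroMeasure_certificate_of_riemannHypothesis`). -/
theorem stub_fakeZeroMeasure_of_riemannHypothesis : RiemannHypothesis → ∀ a : ℝ, 0 < a → ∃ N : ℕ, Real.exp (2 * a) ≤ N ∧ ∃ c : ℕ → ℝ, (∀ n, 0 ≤ c n) ∧ ∃ σ : Measure ℝ, ∀ g : ℝ → ℂ, IsWeilTest g → tsupport g ⊆ Set.Icc (-a) a → Integrable (fun y : ℝ => ‖weilMellin g (1 / 2 + y * I)‖ ^ 2) σ ∧ -(1 / (2 * π)) * (∫ y : ℝ, ‖weilMellin g (1 / 2 + y * I)‖ ^ 2 * (2 * (riemannZeta (1 / 2 + y * I) - ∑ n ∈ Finset.Icc 1 N, (n : ℂ) ^ (-(1 / 2 + y * I))).re - (Complex.digamma (1 / 4 + y / 2 * I)).re + Real.log π - 1)) - 1 / (2 * π) * (∫ y : ℝ, ‖weilMellin g (1 / 2 + y * I)‖ ^ 2 * ∑ n ∈ Finset.Icc 2 N, c n * (2 * Real.cos (y * Real.log n)) / Real.sqrt n) = ∫ y : ℝ, ‖weilMellin g (1 / 2 + y * I)‖ ^ 2 ∂σ := by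
  intro hRH a _ha
  refine ⟨⌈Real.exp (2 * a)⌉₊, Nat.le_ceil _, fun n => Λ n,
    fun _ => ArithmeticFunction.vonMangoldt_nonneg,
    (ENNReal.ofReal (1 / (2 * π))) • (volume : Measure ℝ) +
      Measure.sum (fun ρ : ZetaZeros.riemannZetaNontrivialZeros =>
        (ENNReal.ofReal (riemannZetaZeroOrder (ρ : ℂ) : ℝ)) • Measure.dirac ((ρ : ℂ).im)),
    fun g hg hsupp => ?_⟩
  exact fakeZeroMeasure_certificate_of_riemannHypothesis hRH hg hsupp (Nat.le_ceil _)

/-- Curried form of `stub_fakeZeroMeasure_of_riemannHypothesis`: `RiemannHypothesis` implies the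
spectral fake-zero certificate hypothesis of `signConeOscillatory_of_fakeZeroMeasure` at the cutoff `a`. -/
theorem fakeZeroMeasure_of_riemannHypothesis (hRH : RiemannHypothesis) {a : ℝ} (ha : 0 < a) :
    ∃ N : ℕ, Real.exp (2 * a) ≤ N ∧ ∃ c : ℕ → ℝ, (∀ n, 0 ≤ c n) ∧
      ∃ σ : Measure ℝ, ∀ g : ℝ → ℂ, IsWeilTest g → tsupport g ⊆ Set.Icc (-a) a →
        Integrable (fun y : ℝ => ‖weilMellin g (1 / 2 + y * I)‖ ^ 2) σ ∧
        -(1 / (2 * π)) * (∫ y : ℝ, ‖weilMellin g (1 / 2 + y * I)‖ ^ 2 *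
            (2 * (riemannZeta (1 / 2 + y * I)
                    - ∑ n ∈ Finset.Icc 1 N, (n : ℂ) ^ (-(1 / 2 + y * I))).re
              - (Complex.digamma (1 / 4 + y / 2 * I)).re + Real.log π - 1))
          - 1 / (2 * π) * (∫ y : ℝ, ‖weilMellin g (1 / 2 + y * I)‖ ^ 2 *
              ∑ n ∈ Finset.Icc 2 N, c n * (2 * Real.cos (y * Real.log n)) / Real.sqrt n)
          = ∫ y : ℝ, ‖weilMellin g (1 / 2 + y * I)‖ ^ 2 ∂σ :=
  stub_fakeZeroMeasure_of_riemannHypothesis hRH a ha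

end Summit.RiemannHypothesis.RiemannHypothesis.Theorems.SignConeOscillatory

end
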